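import Summits.ResolutionOfSingularities.ResolutionOfSingularities.Theorems.PinchTowerTau

/-!
# NearExit (S6-V) — the uniform directrix at a rational near point and its shape `(y₀ + r t)ⁿ`

Node «NearExit» of `decomp-res-lens-2` (g33), see `NearExitTau.lean`.  Ring-level kernel of the VERY-NEAR TEST (V) at the
RATIONAL matched point `x′_w` of the first blow-up: `A` local Noetherian (the local ring of `x′_w`), `(y₀, t)` part of a
regular system of parameters (`t` the exceptional parameter, `y₀` the translated directrix variable), `J ⊆ 𝔪ⁿ` (near)
containing the chart element `f′ ≡ y₀ⁿ (mod t)`.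

* `exists_uniform_directrix`: `τ(J, n) ≤ 1` ⇒ ONE `ℓ ∈ 𝔪` with `h ≡ c_h ℓⁿ (mod 𝔪ⁿ⁺¹)` for EVERY `h ∈ J ∩ 𝔪ⁿ`
  (uniform version of `PinchTower.exists_sub_mem_pow_succ_of_tau_le_one`, from the tree's
  `exists_forall_eq_C_mul_pow_of_hironakaTau_eq_one`).
* `pow_not_mem_span_sup_pow`: `y₀ⁿ ∉ (t) + 𝔪ⁿ⁺¹`.
* `directrix_shape` [KERNEL V]: with `f′ ∈ J`, `f′ − y₀ⁿ ∈ (t)`: the uniform `ℓ` may be taken to be `y₀ + r·t`: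
  `∃ r, ∀ h ∈ J, ∃ μ, h − μ (y₀ + r t)ⁿ ∈ 𝔪ⁿ⁺¹` (the coefficient of `y₀` in `ℓ` is a unit: reduce modulo `t`).

Sources: [CossartPiltant2008] proof of Prop. 4.2 (b); [Hironaka1970] Thm. 3; [CossartJannsenSaito2020] Ch. 2.
-/

open IsLocalRing
open Literature.AlgebraicGeometry.Resolution
open Summit.ResolutionOfSingularities.ResolutionOfSingularities.Theorems.PinchTower

namespace Summit.ResolutionOfSingularities.ResolutionOfSingularities.Theorems.NearExit

section Directrix

open MvPolynomial

variable {A : Type} [CommRing A] [IsLocalRing A]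

/-- **Uniform directrix for `τ ≤ 1`**: one `ℓ ∈ 𝔪` such that every `h ∈ J ∩ 𝔪ⁿ` is `≡ c·ℓⁿ (mod 𝔪ⁿ⁺¹)`.
[cite: CossartPiltant2008, §4 p. 11] -/
theorem exists_uniform_directrix {d : ℕ} (x : Fin d → A) (hx : Ideal.span (Set.range x) = maximalIdeal A)
    {J : Ideal A} {n : ℕ} (hn : 1 ≤ n) (hτ : hironakaTauAt x J n ≤ 1) :
    ∃ ℓ : A, ℓ ∈ maximalIdeal A ∧
      ∀ h ∈ J, h ∈ maximalIdeal A ^ n → ∃ c : A, h - c * ℓ ^ n ∈ maximalIdeal A ^ (n + 1) := by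
  classical
  -- generic step: for `h ∈ J ∩ 𝔪ⁿ` written `h = F(x)` (`F` a form of degree `n`), a form `F₀` with the same reduction
  -- as `F` has `h − F₀(x) ∈ 𝔪ⁿ⁺¹`
  have key : ∀ (h : A) (F F₀ : MvPolynomial (Fin d) A), F.IsHomogeneous n → MvPolynomial.eval x F = h →
      F₀.IsHomogeneous n → MvPolynomial.map (residue A) F₀ = MvPolynomial.map (residue A) F →
      h - MvPolynomial.eval x F₀ ∈ maximalIdeal A ^ (n + 1) := by
    intro h F F₀ hFh hFe hF₀ hF₀G
    have hdiff : MvPolynomial.map (residue A) (F - F₀) = 0 := by rw [map_sub, hF₀G, sub_self]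
    have hmem := eval_mem_mul_span_pow x (hFh.sub hF₀) ((PinchTower.map_residue_eq_zero_iff _).mp hdiff)
    rw [map_sub, hFe, hx, ← pow_succ'] at hmem
    exact hmem
  have hGmem : ∀ h ∈ J, ∀ F : MvPolynomial (Fin d) A, F.IsHomogeneous n → MvPolynomial.eval x F = h →
      MvPolynomial.map (residue A) F ∈ initialForms x J n := fun h hJ F hFh hFe =>
    (mem_initialForms_iff x).mpr ⟨F, hFh, by rw [hFe]; exact hJ, rfl⟩
  rcases Nat.lt_or_ge (hironakaTau (ResidueField A)
    (initialForms x J n : Set (MvPolynomial (Fin d) (ResidueField A)))) 1 with h0 | h1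
  · -- `τ = 0`: every initial form of degree `n ≥ 1` vanishes
    have hτ0 : hironakaTau (ResidueField A)
        (initialForms x J n : Set (MvPolynomial (Fin d) (ResidueField A))) = 0 := by omega
    refine ⟨0, Ideal.zero_mem _, fun h hJ hm => ⟨0, ?_⟩⟩
    obtain ⟨F, hFh, hFe⟩ := exists_isHomogeneous_of_mem_span_pow x n (by rw [hx]; exact hm)
    obtain ⟨c, hc⟩ := (hironakaTau_eq_zero_iff (ResidueField A) _).mp hτ0 (hGmem h hJ F hFh hFe)
    have hGh : (MvPolynomial.map (residue A) F).IsHomogeneous n := hFh.map _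
    have hG0 : MvPolynomial.map (residue A) F = 0 := by
      by_contra hne
      have hdeg0 : (MvPolynomial.map (residue A) F).IsHomogeneous 0 := by rw [← hc]; exact isHomogeneous_C _ _
      exact absurd (hdeg0.inj_right hGh hne) (by omega)
    have := key h F 0 hFh hFe (isHomogeneous_zero _ _ _) (by rw [map_zero, hG0])
    simpa using this
  · -- `τ = 1`: ONE functional `ℓ` for all initial forms; lift it once
    have hτ1 : hironakaTau (ResidueField A)
        (initialForms x J n : Set (MvPolynomial (Fin d) (ResidueField A))) = 1 := le_antisymm hτ h1
    obtain ⟨ℓ, -, -, hℓ⟩ := exists_forall_eq_C_mul_pow_of_hironakaTau_eq_one (ResidueField A) hτ1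
    choose a ha using fun i => IsLocalRing.residue_surjective (ℓ (Pi.single i 1))
    have hL : (∑ i, C (a i) * X i : MvPolynomial (Fin d) A).IsHomogeneous 1 := by
      refine IsHomogeneous.sum _ _ _ fun i _ => ?_
      have h1 := (isHomogeneous_C (Fin d) (a i)).mul (isHomogeneous_X A i)
      rwa [zero_add] at h1
    refine ⟨∑ i, a i * x i, ?_, fun h hJ hm => ?_⟩
    · refine Ideal.sum_mem _ fun i _ => Ideal.mul_mem_left _ _ ?_
      rw [← hx]; exact Ideal.subset_span ⟨i, rfl⟩
    obtain ⟨F, hFh, hFe⟩ := exists_isHomogeneous_of_mem_span_pow x n (by rw [hx]; exact hm)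
    obtain ⟨cbar, hc⟩ := hℓ _ (hGmem h hJ F hFh hFe) n (hFh.map _)
    obtain ⟨c, rfl⟩ := IsLocalRing.residue_surjective cbar
    refine ⟨c, ?_⟩
    set F₀ : MvPolynomial (Fin d) A := C c * (∑ i, C (a i) * X i) ^ n with hF₀
    have hF₀h : F₀.IsHomogeneous n := by
      have h1 : F₀.IsHomogeneous (0 + 1 * n) := (isHomogeneous_C (Fin d) c).mul (hL.pow n)
      have e : 0 + 1 * n = n := by omega
      rw [e] at h1
      exact h1
    have hF₀G : MvPolynomial.map (residue A) F₀ = MvPolynomial.map (residue A) F := by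
      rw [hc, hF₀, map_mul, map_C, map_pow, map_sum, linearFormPoly]
      congr 2
      refine Finset.sum_congr rfl fun i _ => ?_
      rw [map_mul, map_C, map_X, ha]
    have hev : MvPolynomial.eval x F₀ = c * (∑ i, a i * x i) ^ n := by
      simp only [hF₀, map_mul, map_pow, map_sum, eval_C, eval_X]
    have := key h F F₀ hFh hFe hF₀h hF₀G
    rwa [hev] at this

variable [IsNoetherianRing A]

/-- `(y₀, t)` an r.s.o.p.-part ⇒ `y₀ⁿ ∉ (t) + 𝔪ⁿ⁺¹` (orders in the regular local ring `A/(t)`).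
[cite: ZariskiSamuel1960, Ch. VIII §1 Thm. 1] -/
theorem pow_not_mem_span_sup_pow {y₀ t : A} (hyt : IsRsopPart ![y₀, t]) (n : ℕ) :
    y₀ ^ n ∉ Ideal.span (Set.range ![t]) ⊔ maximalIdeal A ^ (n + 1) := by
  classical
  have hty : IsRsopPart ![t, y₀] := by
    have := hyt.comp (fun i : Fin 2 => (1 : Fin 2) - i) (fun a b h => by
      fin_cases a <;> fin_cases b <;> simp_all)
    convert this using 1
    funext i; fin_cases i <;> rfl
  have ht1 : IsRsopPart ![t] := by
    have := hty.comp (fun _ : Fin 1 => (0 : Fin 2)) (fun a b _ => Subsingleton.elim a b)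
    convert this using 1
    funext i; fin_cases i; rfl
  haveI : IsRegularLocalRing (A ⧸ Ideal.span (Set.range ![t])) := ht1.isRegularLocalRing_quotient
  have hybar := mk_u_not_mem_sq hty
  intro hmem
  have h1 := (mk_mem_pow_maximalIdeal_iff (Ideal.span (Set.range ![t])) _ _).mpr hmem
  rw [map_pow] at h1
  have h2 := pow_not_mem_pow_of_not_mem_pow hybar n
  rw [mul_one] at h2
  exact h2 h1

/-- **THE DIRECTRIX SHAPE AT A RATIONAL NEAR POINT** [KERNEL V]: `(y₀, t)` an r.s.o.p.-part, `n ≥ 1`, `J ⊆ 𝔪ⁿ`,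
`f′ ∈ J` with `f′ ≡ y₀ⁿ (mod t)`, and a uniform `ℓ ∈ 𝔪` with `h ≡ c_h ℓⁿ (mod 𝔪ⁿ⁺¹)` on `J` ⇒ the uniform form is
`(y₀ + r t)ⁿ`: `∃ r, ∀ h ∈ J, ∃ μ, h − μ (y₀ + r t)ⁿ ∈ 𝔪ⁿ⁺¹`.  (Applied to `f′`: the scalar `c` is a unit and
`ℓ ∈ (y₀, t) + 𝔪²`, `ℓ = b₀ y₀ + b₁ t + μ₂`; modulo `t`, `y₀ⁿ ≡ c b₀ⁿ y₀ⁿ (mod 𝔪̄ⁿ⁺¹)` forces `b₀` to be a unit;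
`r = b₁/b₀`.) [cite: CossartPiltant2008, Prop. 4.2 (b)] [cite: Hironaka1970, Thm. 3] -/
theorem directrix_shape {y₀ t f' ℓ : A} {J : Ideal A} {n : ℕ} (hyt : IsRsopPart ![y₀, t]) (hn : 1 ≤ n)
    (hJ : J ≤ maximalIdeal A ^ n) (hf' : f' ∈ J) (hf't : f' - y₀ ^ n ∈ Ideal.span (Set.range ![t]))
    (hℓm : ℓ ∈ maximalIdeal A)
    (hℓ : ∀ h ∈ J, h ∈ maximalIdeal A ^ n → ∃ c : A, h - c * ℓ ^ n ∈ maximalIdeal A ^ (n + 1)) :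
    ∃ r : A, ∀ h ∈ J, ∃ μ : A, h - μ * (y₀ + r * t) ^ n ∈ maximalIdeal A ^ (n + 1) := by
  classical
  have hy₀m : y₀ ∈ maximalIdeal A := hyt.mem_maximalIdeal 0
  have htm : t ∈ maximalIdeal A := hyt.mem_maximalIdeal 1
  set K₁ : Ideal A := Ideal.span (Set.range ![t]) with hK₁
  set K₂ : Ideal A := Ideal.span (Set.range ![y₀, t]) with hK₂
  have htK₁ : t ∈ K₁ := Ideal.subset_span ⟨0, rfl⟩
  have hy₀K₂ : y₀ ∈ K₂ := Ideal.subset_span ⟨0, rfl⟩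
  have htK₂ : t ∈ K₂ := Ideal.subset_span ⟨1, rfl⟩
  have hK12 : K₁ ≤ K₂ := by
    rw [hK₁, Ideal.span_le]
    rintro _ ⟨i, rfl⟩
    fin_cases i
    exact htK₂
  have hynot := pow_not_mem_span_sup_pow hyt n
  -- the scalar of `f′`
  obtain ⟨c, hc⟩ := hℓ f' hf' (hJ hf')
  -- (1) `c` is a unit: else `f′ ∈ 𝔪ⁿ⁺¹` and `y₀ⁿ ∈ (t) + 𝔪ⁿ⁺¹`
  have hcu : IsUnit c := by
    by_contra hcu
    have hcm : c ∈ maximalIdeal A := (IsLocalRing.mem_maximalIdeal _).mpr hcu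
    apply hynot
    have h1 : f' ∈ maximalIdeal A ^ (n + 1) := by
      have : f' = (f' - c * ℓ ^ n) + c * ℓ ^ n := by ring
      rw [this]
      refine Ideal.add_mem _ hc ?_
      rw [pow_succ']; exact Ideal.mul_mem_mul hcm (Ideal.pow_mem_pow hℓm n)
    have : y₀ ^ n = f' - (f' - y₀ ^ n) := by ring
    rw [this]
    exact Ideal.sub_mem _ (Ideal.mem_sup_right h1) (Ideal.mem_sup_left hf't)
  -- (2) `ℓ ∈ (y₀, t) + 𝔪²`
  haveI hreg2 : IsRegularLocalRing (A ⧸ K₂) := hyt.isRegularLocalRing_quotient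
  have hf'K : f' ∈ K₂ := by
    have : f' = (f' - y₀ ^ n) + y₀ ^ n := by ring
    rw [this]
    refine Ideal.add_mem _ (hK12 hf't) ?_
    obtain ⟨n', rfl⟩ : ∃ n', n = n' + 1 := ⟨n - 1, by omega⟩
    rw [pow_succ']; exact Ideal.mul_mem_right _ _ hy₀K₂
  have h2 : Ideal.Quotient.mk K₂ ℓ ^ n ∈ maximalIdeal (A ⧸ K₂) ^ (n + 1) := by
    have h1 : Ideal.Quotient.mk K₂ (c * ℓ ^ n) ∈ maximalIdeal (A ⧸ K₂) ^ (n + 1) := by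
      have h' : c * ℓ ^ n = f' - (f' - c * ℓ ^ n) := by ring
      rw [h', map_sub, Ideal.Quotient.eq_zero_iff_mem.mpr hf'K, zero_sub, neg_mem_iff,
        ← map_mk_maximalIdeal_eq K₂, ← Ideal.map_pow]
      exact Ideal.mem_map_of_mem _ hc
    rw [map_mul, map_pow] at h1
    obtain ⟨w, hw⟩ := hcu.map (Ideal.Quotient.mk K₂)
    have heq : Ideal.Quotient.mk K₂ ℓ ^ n = ↑w⁻¹ * (Ideal.Quotient.mk K₂ c * Ideal.Quotient.mk K₂ ℓ ^ n) := by
      rw [← hw, ← mul_assoc, Units.inv_mul, one_mul]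
    rw [heq]
    exact Ideal.mul_mem_left _ _ h1
  have h3 : Ideal.Quotient.mk K₂ ℓ ∈ maximalIdeal (A ⧸ K₂) ^ 2 := by
    by_contra hℓ2
    have := pow_not_mem_pow_of_not_mem_pow hℓ2 n
    rw [mul_one] at this
    exact this h2
  have h4 : ℓ ∈ K₂ ⊔ maximalIdeal A ^ 2 := (mk_mem_pow_maximalIdeal_iff K₂ ℓ 2).mp h3
  obtain ⟨p, hp, μ₂, hμ₂, hpμ⟩ := Submodule.mem_sup.mp h4
  obtain ⟨b, hb⟩ := Ideal.mem_span_range_iff_exists_fun.mp hp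
  have hℓeq : ℓ = b 0 * y₀ + b 1 * t + μ₂ := by
    rw [← hpμ, ← hb, Fin.sum_univ_two]
    simp only [Matrix.cons_val_zero, Matrix.cons_val_one]
  -- (3) `b 0` is a unit: modulo `t`, `y₀ⁿ (1 − c b₀ⁿ) ∈ 𝔪̄ⁿ⁺¹`
  have hstep1 : ℓ ^ n - (b 0 * y₀ + b 1 * t) ^ n ∈ maximalIdeal A ^ (n + 1) := by
    rw [hℓeq]
    exact add_pow_sub_pow_mem (Ideal.add_mem _ (Ideal.mul_mem_left _ _ hy₀m) (Ideal.mul_mem_left _ _ htm)) hμ₂ n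
  have hb0u : IsUnit (b 0) := by
    by_contra hb0
    -- `1 − c b₀ⁿ` is then a unit (as `b₀ ∈ 𝔪`) and `y₀ⁿ ∈ (t) + 𝔪ⁿ⁺¹`
    have hb0m : b 0 ∈ maximalIdeal A := (IsLocalRing.mem_maximalIdeal _).mpr hb0
    apply hynot
    -- `f′ − c (b₀ y₀ + b₁ t)ⁿ ∈ 𝔪ⁿ⁺¹` and `(b₀ y₀ + b₁ t)ⁿ − (b₀ y₀)ⁿ ∈ (t)`
    obtain ⟨q, hq⟩ : ∃ q, (b 0 * y₀ + b 1 * t) ^ n - (b 0 * y₀) ^ n = t * q := by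
      obtain ⟨q, hq⟩ := sub_dvd_pow_sub_pow (b 0 * y₀ + b 1 * t) (b 0 * y₀) n
      refine ⟨b 1 * q, ?_⟩
      rw [hq]; ring
    have hA : f' - c * (b 0 * y₀) ^ n ∈ K₁ ⊔ maximalIdeal A ^ (n + 1) := by
      have : f' - c * (b 0 * y₀) ^ n =
          (f' - c * ℓ ^ n) + c * (ℓ ^ n - (b 0 * y₀ + b 1 * t) ^ n) + c * (t * q) := by rw [← hq]; ring
      rw [this]
      exact Ideal.add_mem _ (Ideal.mem_sup_right (Ideal.add_mem _ hc (Ideal.mul_mem_left _ _ hstep1)))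
        (Ideal.mem_sup_left (Ideal.mul_mem_left _ _ (Ideal.mul_mem_right _ _ htK₁)))
    -- `c (b₀ y₀)ⁿ ∈ 𝔪ⁿ⁺¹` as `b₀ ∈ 𝔪`
    have hB : c * (b 0 * y₀) ^ n ∈ maximalIdeal A ^ (n + 1) := by
      obtain ⟨n', rfl⟩ : ∃ n', n = n' + 1 := ⟨n - 1, by omega⟩
      refine Ideal.mul_mem_left _ _ ?_
      rw [mul_pow, pow_succ (b 0), mul_assoc, pow_succ']
      refine Ideal.mul_mem_left _ _ (Ideal.mul_mem_mul hb0m (Ideal.pow_mem_pow hy₀m _))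
    have : y₀ ^ n = (f' - c * (b 0 * y₀) ^ n) + c * (b 0 * y₀) ^ n - (f' - y₀ ^ n) := by ring
    rw [this]
    exact Ideal.sub_mem _ (Ideal.add_mem _ hA (Ideal.mem_sup_right hB)) (Ideal.mem_sup_left hf't)
  -- (4) `r := b₁ / b₀`
  obtain ⟨u, hu⟩ := hb0u
  refine ⟨b 1 * ↑u⁻¹, fun h hh => ?_⟩
  obtain ⟨ch, hch⟩ := hℓ h hh (hJ hh)
  refine ⟨ch * b 0 ^ n, ?_⟩
  have hℓ' : b 0 * y₀ + b 1 * t = b 0 * (y₀ + b 1 * ↑u⁻¹ * t) := by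
    rw [← hu, mul_add, show (↑u : A) * (b 1 * ↑u⁻¹ * t) = b 1 * t by
      rw [mul_comm (b 1) (↑u⁻¹ : A), mul_assoc, ← mul_assoc (↑u : A), Units.mul_inv, one_mul]]
  have hstep2 : ℓ ^ n - b 0 ^ n * (y₀ + b 1 * ↑u⁻¹ * t) ^ n ∈ maximalIdeal A ^ (n + 1) := by
    rw [← mul_pow, ← hℓ']; exact hstep1
  have : h - ch * b 0 ^ n * (y₀ + b 1 * ↑u⁻¹ * t) ^ n =
      (h - ch * ℓ ^ n) + ch * (ℓ ^ n - b 0 ^ n * (y₀ + b 1 * ↑u⁻¹ * t) ^ n) := by ring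
  rw [this]
  exact Ideal.add_mem _ hch (Ideal.mul_mem_left _ _ hstep2)

end Directrix

end Summit.ResolutionOfSingularities.ResolutionOfSingularities.Theorems.NearExit
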